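import Mathlib
import HarnessLib

/-!
# Brown 2026: the multi-parameter irrationality criterion — Minkowski's theorem on linear forms and the core criterion

Topic `Literature/NumberTheory/Irrationality/Brown2026`. Source: F. Brown, *Mellin transforms, transfinite diameter
and rational approximations of integrals*, arXiv:2604.20741 (April 2026) = Experimental Mathematics (2026),
doi:10.1080/10586458.2026.2695605 [Brown2026Mellin], Sect. 7 "Small linear forms from the geometry of numbers".

HONEST FRAMING (cell pub-zeta5): systematic search; no irrationality claim unless certified. Nothing in this file
concerns `ζ(5)` or Catalan's constant specifically; it is the number-geometric core of the printed criterion.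

## What is printed and what is typed

* **Theorem 7.1 (Minkowski's theorem on linear forms).** "Let `A ∈ M_{n×n}(ℝ)` … Then there exists a non-zero
  integer vector `c ∈ ℤⁿ ∖ {0}` such that `|Σ_j a_ij c_j| ≤ ε_i` for all `1 ≤ i ≤ n`, provided that `∏ ε_i ≥ |det(A)|`.
  In particular, if `det(A) ≠ 0` there exists some `1 ≤ i ≤ n` such that `0 < |Σ_j a_ij c_j| ≤ |det(A)|^{1/n}`."
  PROVED here for `det A ≠ 0` (the case used; `minkowski_linearForms`, `minkowski_linearForms_det`), from Mathlib's
  convex-body theorem `exists_ne_zero_mem_lattice_of_measure_mul_two_pow_le_measure` applied to the parallelepiped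
  `A⁻¹([-ε,ε]ⁿ)` and the lattice `ℤⁿ`. `-- TODO(general form): det A = 0 (degenerate slab), not needed by the source.`
* **Theorem 7.2 (core)** — the source applies Theorem 7.1 to the matrix `Q̃^σ_N = D^ℓ Q^σ D^r` whose entries are
  INTEGER linear forms in the periods and bounds `|det Q^σ_N|` by the squared generalised Vandermonde supremum
  `t_𝓝(fσ)²`. Typed and PROVED here without the analytic bound, for two periods `ξ₁ = 1, ξ₂ = ξ`: for any `N × N`
  matrix `M = P + ξQ` (`P, Q` integer matrices) with `det M ≠ 0` there are integers `k₁, k₂` with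
  `0 < |k₁ + k₂ξ| ≤ |det M|^{1/N}` (`exists_small_form`).
* **Criterion 1.3 / Lemma 7.8 (core, m = 2)** — "`t_{𝓜_N}(σ)² δ_{𝓜_N} → 0` … Then `ξ` is irrational". As a bare
  statement about determinants this needs the normalisation implicit in the source's regime (exponents `e_n` with
  `e_n/N_n → ∞`, Sect. 5 and 7.3): a non-zero degree-`N` integer form in `ξ = p/q` is `≥ q^{−N}`, so what forces
  irrationality is `|det M_N|^{1/N} → 0`, equivalently `|det M_N| < εᴺ` for every `ε > 0` and suitable `N`. PROVED in
  that form: `irrational_of_small_determinants`. (Cor. 7.3, the `dim ≥ 2` version for `m` periods, and the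
  transfinite-diameter bound `|det Q^σ_N| ≤ t²` of Cor. 3.x are not typed here.)
-/

noncomputable section

open MeasureTheory Module Submodule Finset Filter Matrix
open scoped Topology

namespace Literature.NumberTheory.Irrationality.Brown2026

/-! ### Theorem 7.1: Minkowski's theorem on linear forms (`det A ≠ 0`) -/

/-- **Minkowski's theorem on linear forms** (the case `det A ≠ 0`): if `ε_i ≥ 0` and `∏ ε_i ≥ |det A|`, there is
`c ∈ ℤⁿ ∖ {0}` with `|(Ac)_i| ≤ ε_i` for all `i`. [cite: Brown2026Mellin, Theorem 7.1] -/
theorem minkowski_linearForms {n : ℕ} [NeZero n] (A : Matrix (Fin n) (Fin n) ℝ) (hA : A.det ≠ 0)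
    (ε : Fin n → ℝ) (hε : ∀ i, 0 ≤ ε i) (hprod : |A.det| ≤ ∏ i, ε i) :
    ∃ c : Fin n → ℤ, c ≠ 0 ∧ ∀ i, |(A.mulVec fun j => (c j : ℝ)) i| ≤ ε i := by
  classical
  -- the box and the parallelepiped `s = A⁻¹(box)`
  set box : Set (Fin n → ℝ) := Set.Icc (-ε) ε with hbox
  set g : (Fin n → ℝ) →ₗ[ℝ] (Fin n → ℝ) := Matrix.toLin' A⁻¹ with hg
  set s : Set (Fin n → ℝ) := g '' box with hs
  -- the lattice `ℤⁿ`
  let b := Pi.basisFun ℝ (Fin n)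
  have h_fund := ZSpan.isAddFundamentalDomain' b volume
  have : Countable (span ℤ (Set.range b)).toAddSubgroup := by
    change Countable (span ℤ (Set.range b)); infer_instance
  -- symmetry, convexity, compactness of `s`
  have h_symm : ∀ x ∈ s, -x ∈ s := by
    rintro x ⟨y, hy, rfl⟩
    refine ⟨-y, ?_, by simp⟩
    rw [hbox, Set.mem_Icc] at hy ⊢
    constructor
    · intro i; have := hy.2 i; simp only [Pi.neg_apply] at *; linarith
    · intro i; have := hy.1 i; simp only [Pi.neg_apply] at *; linarith
  have h_conv : Convex ℝ s := (convex_Icc (-ε) ε).linear_image g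
  have h_cpt : IsCompact s := (isCompact_Icc : IsCompact box).image g.continuous_of_finiteDimensional
  -- volumes
  have hdetg : LinearMap.det g = (A.det)⁻¹ := by
    rw [hg, LinearMap.det_toLin', Matrix.det_nonsing_inv, Ring.inverse_eq_inv']
  have hprodpos : 0 ≤ ∏ i, ε i := Finset.prod_nonneg fun i _ => hε i
  have hvol_box : volume box = ENNReal.ofReal (∏ i, (2 * ε i)) := by
    rw [hbox, Real.volume_Icc_pi, ENNReal.ofReal_prod_of_nonneg fun i _ => by linarith [hε i]]
    refine Finset.prod_congr rfl fun i _ => ?_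
    simp only [Pi.neg_apply]; ring_nf
  have hvol_s : volume s = ENNReal.ofReal (|A.det|⁻¹ * ∏ i, (2 * ε i)) := by
    rw [hs, MeasureTheory.Measure.addHaar_image_linearMap, hdetg, hvol_box, abs_inv,
      ← ENNReal.ofReal_mul (by positivity)]
  have hvol_F : volume (ZSpan.fundamentalDomain b) = 1 := by
    rw [ZSpan.fundamentalDomain_pi_basisFun, volume_pi_pi]
    simp
  have h_le : volume (ZSpan.fundamentalDomain b) * 2 ^ finrank ℝ (Fin n → ℝ) ≤ volume s := by
    rw [hvol_F, one_mul, Module.finrank_fin_fun, hvol_s]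
    have h2 : (2 : ENNReal) ^ n = ENNReal.ofReal ((2 : ℝ) ^ n) := by
      rw [ENNReal.ofReal_pow (by norm_num)]; norm_num
    rw [h2]
    apply ENNReal.ofReal_le_ofReal
    -- `2^n ≤ |det A|⁻¹ * ∏ (2 ε_i) = 2^n * (∏ ε_i) / |det A|`
    have hApos : 0 < |A.det| := abs_pos.2 hA
    rw [Finset.prod_mul_distrib, Finset.prod_const, Finset.card_univ, Fintype.card_fin]
    rw [show |A.det|⁻¹ * ((2 : ℝ) ^ n * ∏ i, ε i) = 2 ^ n * ((∏ i, ε i) / |A.det|) by ring]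
    have : 1 ≤ (∏ i, ε i) / |A.det| := by rw [le_div_iff₀ hApos, one_mul]; exact hprod
    nlinarith [pow_pos (show (0:ℝ) < 2 by norm_num) n]
  obtain ⟨⟨x, hx⟩, h_nz, h_mem⟩ :=
    exists_ne_zero_mem_lattice_of_measure_mul_two_pow_le_measure h_fund h_symm h_conv h_cpt h_le
  -- `x` has integer coordinates
  rw [mem_toAddSubgroup, Basis.mem_span_iff_repr_mem] at hx
  choose c hc using hx
  have hxc : x = fun j => (c j : ℝ) := by
    funext j
    have := hc j
    simp only [b, Pi.basisFun_repr] at this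
    exact this.symm
  refine ⟨c, ?_, ?_⟩
  · intro hc0
    apply h_nz
    have : x = 0 := by rw [hxc]; funext j; simp [hc0]
    exact Subtype.ext this
  · -- `A x = y ∈ box`
    obtain ⟨y, hy, hyx⟩ := h_mem
    have hyx' : g y = x := hyx
    have hAx : A.mulVec x = y := by
      rw [← hyx', hg, Matrix.toLin'_apply, Matrix.mulVec_mulVec, Matrix.mul_nonsing_inv _ (isUnit_iff_ne_zero.2 hA),
        Matrix.one_mulVec]
    intro i
    rw [← hxc, hAx]
    rw [hbox, Set.mem_Icc] at hy
    exact abs_le.2 ⟨by simpa using hy.1 i, hy.2 i⟩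

/-- The displayed consequence of Theorem 7.1: if `det A ≠ 0` there is `c ∈ ℤⁿ ∖ {0}` with
`|(Ac)_i| ≤ |det A|^{1/n}` for ALL `i`, and `0 < |(Ac)_i|` for SOME `i`. [cite: Brown2026Mellin, Theorem 7.1, display (7.1)] -/
theorem minkowski_linearForms_det {n : ℕ} [NeZero n] (A : Matrix (Fin n) (Fin n) ℝ) (hA : A.det ≠ 0) :
    ∃ c : Fin n → ℤ, c ≠ 0 ∧ (∀ i, |(A.mulVec fun j => (c j : ℝ)) i| ≤ |A.det| ^ (1 / (n : ℝ)))
      ∧ ∃ i, 0 < |(A.mulVec fun j => (c j : ℝ)) i| := by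
  have hn : (n : ℝ) ≠ 0 := by exact_mod_cast (NeZero.ne n)
  set e : ℝ := |A.det| ^ (1 / (n : ℝ)) with he
  have he0 : 0 ≤ e := Real.rpow_nonneg (abs_nonneg _) _
  have hprod : |A.det| ≤ ∏ _i : Fin n, e := by
    rw [Finset.prod_const, Finset.card_univ, Fintype.card_fin, he, ← Real.rpow_natCast,
      ← Real.rpow_mul (abs_nonneg _), one_div_mul_cancel hn, Real.rpow_one]
  obtain ⟨c, hc0, hc⟩ := minkowski_linearForms A hA (fun _ => e) (fun _ => he0) hprod
  refine ⟨c, hc0, hc, ?_⟩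
  -- some coordinate of `A c` is non-zero since `A` is invertible and `c ≠ 0`
  by_contra hall
  simp only [not_exists, not_lt] at hall
  have hzero : A.mulVec (fun j => (c j : ℝ)) = 0 := by
    funext i; exact abs_nonpos_iff.1 (hall i)
  have hcR : (fun j => (c j : ℝ)) = 0 := by
    have := congrArg (A⁻¹.mulVec) hzero
    rwa [Matrix.mulVec_mulVec, Matrix.nonsing_inv_mul _ (isUnit_iff_ne_zero.2 hA), Matrix.one_mulVec,
      Matrix.mulVec_zero] at this
  apply hc0
  funext j
  have h := congrFun hcR j
  simp only [Pi.zero_apply, Int.cast_eq_zero] at h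
  simpa using h

/-! ### Theorem 7.2 (core) and the criterion for two periods `1, ξ` -/

/-- The matrix `P + ξ Q` of integer linear forms in `1, ξ` (`P, Q ∈ M_N(ℤ)`), as a real matrix — the shape of the
source's `Q̃^σ_N = D^ℓ_N Q^σ_N D^r_N ∈ M_{N×N}(ℤ[ξ₁, ξ₂])` for `ξ₁ = 1, ξ₂ = ξ`. [cite: Brown2026Mellin, Sect. 7.2, display (7.2)] -/
def formMatrix {N : ℕ} (P Q : Matrix (Fin N) (Fin N) ℤ) (ξ : ℝ) : Matrix (Fin N) (Fin N) ℝ :=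
  fun i j => (P i j : ℝ) + ξ * (Q i j : ℝ)

/-- **Theorem 7.2, core** (two periods `1, ξ`; the source's analytic bound `|det Q^σ_N| ≤ t_𝓝(fσ)²` is not
included): if `det(P + ξQ) ≠ 0` then there is a NON-ZERO integer linear form with
`0 < |k₁ + k₂ ξ| ≤ |det(P + ξQ)|^{1/N}`. [cite: Brown2026Mellin, Theorem 7.2 (with Theorem 7.1)] -/
theorem exists_small_form {N : ℕ} [NeZero N] (P Q : Matrix (Fin N) (Fin N) ℤ) (ξ : ℝ)
    (hdet : (formMatrix P Q ξ).det ≠ 0) :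
    ∃ k₁ k₂ : ℤ, 0 < |(k₁ : ℝ) + k₂ * ξ| ∧ |(k₁ : ℝ) + k₂ * ξ| ≤ |(formMatrix P Q ξ).det| ^ (1 / (N : ℝ)) := by
  obtain ⟨c, -, hle, i, hpos⟩ := minkowski_linearForms_det (formMatrix P Q ξ) hdet
  refine ⟨∑ j, P i j * c j, ∑ j, Q i j * c j, ?_, ?_⟩
  · convert hpos using 2
    simp only [Matrix.mulVec, dotProduct, formMatrix]; push_cast
    simp only [Finset.sum_mul, ← Finset.sum_add_distrib]
    refine Finset.sum_congr rfl fun j _ => by ring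
  · convert hle i using 2
    simp only [Matrix.mulVec, dotProduct, formMatrix]; push_cast
    simp only [Finset.sum_mul, ← Finset.sum_add_distrib]
    refine Finset.sum_congr rfl fun j _ => by ring

/-- **Criterion 1.3 / Lemma 7.8, core form for `m = 2`** (periods `1, ξ`): if for every `ε > 0` there is an
`N ≥ 1` and a matrix of integer linear forms `P + ξQ ∈ M_N` with NON-ZERO determinant of absolute value `< εᴺ`
(i.e. `|det|^{1/N} → 0` along a sequence — the normalised form of the printed "`t²δ → 0`"), then `ξ` is irrational.
Proof: for `ξ = p/q`, Theorem 7.2 gives a non-zero form `|k₁ + k₂ξ| < 1/q`, but such a form is `≥ 1/q`.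
[cite: Brown2026Mellin, Criterion 1.3 and Lemma 7.8 (via Theorems 7.1–7.2)] -/
theorem irrational_of_small_determinants (ξ : ℝ)
    (h : ∀ ε : ℝ, 0 < ε → ∃ N : ℕ, ∃ _ : NeZero N, ∃ P Q : Matrix (Fin N) (Fin N) ℤ,
      (formMatrix P Q ξ).det ≠ 0 ∧ |(formMatrix P Q ξ).det| < ε ^ N) :
    Irrational ξ := by
  rw [irrational_iff_ne_rational]
  intro a b hb0 hξ
  have hbR : (b : ℝ) ≠ 0 := by exact_mod_cast hb0
  have hbpos : (0 : ℝ) < |(b : ℝ)| := abs_pos.2 hbR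
  -- every form `k₁ + k₂ ξ` times `b` is an integer
  have hform : ∀ k₁ k₂ : ℤ, ((k₁ : ℝ) + k₂ * ξ) * b = ((k₁ * b + k₂ * a : ℤ) : ℝ) := by
    intro k₁ k₂
    rw [hξ]; push_cast
    calc ((k₁ : ℝ) + k₂ * (a / b)) * b = k₁ * b + k₂ * ((a : ℝ) / b * b) := by ring
      _ = k₁ * b + k₂ * a := by rw [div_mul_cancel₀ (a : ℝ) hbR]
  -- apply the hypothesis with `ε = 1/|b|`
  obtain ⟨N, _, P, Q, hdet, hsmall⟩ := h (1 / |(b : ℝ)|) (by positivity)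
  obtain ⟨k₁, k₂, hpos, hle⟩ := exists_small_form P Q ξ hdet
  have hN : (N : ℝ) ≠ 0 := by exact_mod_cast (NeZero.ne N)
  -- `|det|^{1/N} < 1/|b|`
  have hroot : |(formMatrix P Q ξ).det| ^ (1 / (N : ℝ)) < 1 / |(b : ℝ)| := by
    have h0 : 0 ≤ |(formMatrix P Q ξ).det| := abs_nonneg _
    have h1 : (|(formMatrix P Q ξ).det| ^ (1 / (N : ℝ))) ^ N = |(formMatrix P Q ξ).det| := by
      rw [← Real.rpow_natCast, ← Real.rpow_mul h0, one_div_mul_cancel hN, Real.rpow_one]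
    by_contra hge
    rw [not_lt] at hge
    have : (1 / |(b : ℝ)|) ^ N ≤ (|(formMatrix P Q ξ).det| ^ (1 / (N : ℝ))) ^ N :=
      pow_le_pow_left₀ (by positivity) hge N
    rw [h1] at this
    linarith
  -- but a non-zero form is `≥ 1/|b|`
  set m : ℤ := k₁ * b + k₂ * a with hmdef
  have hm : ((k₁ : ℝ) + k₂ * ξ) * b = m := hform k₁ k₂
  have hm0 : m ≠ 0 := by
    intro hm0
    rw [hm0, Int.cast_zero, mul_eq_zero] at hm
    rcases hm with hm | hm
    · rw [hm, abs_zero] at hpos; exact lt_irrefl _ hpos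
    · exact hbR hm
  have hge : 1 / |(b : ℝ)| ≤ |(k₁ : ℝ) + k₂ * ξ| := by
    have h1 : (1 : ℝ) ≤ |(m : ℝ)| := by exact_mod_cast Int.one_le_abs hm0
    rw [← hm, abs_mul] at h1
    rw [div_le_iff₀ hbpos]; linarith
  linarith

/-! ### From the printed limit criterion (Criterion 1.4 / Cor. 7.3 shape) to the `N`-th-root form -/

/-- **The normalisation behind Criterion 1.4** (PROVED bookkeeping): suppose along a sequence of modules of ranks
`N_n ≥ 1` with exponents `e_n` satisfying `e_n / N_n → ∞` (as for the rectangular modules of the source,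
`e_n ~ (r/2) n^{r+1}`, `N_n = (n+1)^r`) the matrices `P_n + ξ Q_n` of integer linear forms have non-zero determinant
with `|det (P_n + ξ Q_n)| ≤ ρ^{e_n}` eventually, for some `0 ≤ ρ < 1` — e.g. `ρ = T²Δ` when `t_n ≤ T^{e_n}`, `δ_n ≤ Δ^{e_n}`
and `|det| ≤ t_n² δ_n` (the source's `|det Q̃^σ_N| ≤ t_𝓝(fσ)² δ_N`, so that `Sup² · δ_𝓝 < 1` is `ρ < 1`). Then `ξ` is
irrational. [cite: Brown2026Mellin, Criterion 1.4 and Corollary 7.3 (m = 2)] -/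
theorem irrational_of_det_le_pow (ξ : ℝ) (N e : ℕ → ℕ) (P Q : (n : ℕ) → Matrix (Fin (N n)) (Fin (N n)) ℤ)
    (hN : ∀ n, 0 < N n) (hdet0 : ∀ n, (formMatrix (P n) (Q n) ξ).det ≠ 0) {ρ : ℝ} (hρ0 : 0 ≤ ρ) (hρ1 : ρ < 1)
    (hbound : ∀ᶠ n in atTop, |(formMatrix (P n) (Q n) ξ).det| ≤ ρ ^ (e n))
    (he : Tendsto (fun n => (e n : ℝ) / N n) atTop atTop) :
    Irrational ξ := by
  apply irrational_of_small_determinants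
  intro ε hε
  -- it suffices to find `n` with `ρ^{e n} < ε^{N n}`
  suffices h : ∃ᶠ n in atTop, ρ ^ (e n) < ε ^ (N n) by
    obtain ⟨n, hn1, hn2⟩ := (h.and_eventually hbound).exists
    exact ⟨N n, NeZero.of_pos (hN n), P n, Q n, hdet0 n, lt_of_le_of_lt hn2 hn1⟩
  refine Eventually.frequently ?_
  rcases hρ0.eq_or_lt with hρ | hρ
  · -- `ρ = 0`: `0^{e n} = 0 < ε^{N n}` as soon as `e n ≥ 1`
    have hev : ∀ᶠ n in atTop, (1 : ℝ) ≤ (e n : ℝ) / N n := tendsto_atTop.1 he 1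
    filter_upwards [hev] with n hn
    have hNn : (0 : ℝ) < N n := by exact_mod_cast hN n
    have hen : 1 ≤ e n := by
      have : (1 : ℝ) * N n ≤ e n := (le_div_iff₀ hNn).1 hn
      have : (N n : ℝ) ≤ e n := by linarith
      exact_mod_cast (le_trans (Nat.one_le_of_lt (hN n)) (by exact_mod_cast this))
    rw [← hρ, zero_pow (by omega)]
    exact pow_pos hε _
  · -- `0 < ρ < 1`: compare logarithms
    set K : ℝ := Real.log ε / Real.log ρ + 1 with hK
    have hlogρ : Real.log ρ < 0 := Real.log_neg hρ hρ1
    have hev : ∀ᶠ n in atTop, K ≤ (e n : ℝ) / N n := tendsto_atTop.1 he K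
    filter_upwards [hev] with n hn
    have hNn : (0 : ℝ) < N n := by exact_mod_cast hN n
    have h1 : K * N n ≤ e n := (le_div_iff₀ hNn).1 hn
    -- `e n · log ρ < N n · log ε`
    have h2 : (e n : ℝ) * Real.log ρ < N n * Real.log ε := by
      have h3 : (Real.log ε / Real.log ρ) * N n < e n := by
        have : (Real.log ε / Real.log ρ) * N n < K * N n := by
          rw [hK]; nlinarith
        linarith
      have h4 : (e n : ℝ) * Real.log ρ < (Real.log ε / Real.log ρ * N n) * Real.log ρ :=
        mul_lt_mul_of_neg_right h3 hlogρ
      have h5 : (Real.log ε / Real.log ρ * N n) * Real.log ρ = N n * Real.log ε := by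
        rw [mul_right_comm, div_mul_cancel₀ _ hlogρ.ne, mul_comm]
      linarith
    rw [← Real.log_lt_log_iff (pow_pos hρ _) (pow_pos hε _), Real.log_pow, Real.log_pow]
    exact h2

end Literature.NumberTheory.Irrationality.Brown2026
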